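import Summits.PneNP.PneNP.Theses.RootDecompBranchingProgram
import Summits.PneNP.PneNP.Theorems.SoloBlindAnchor
import Literature.Computability.Complexity.ConstantDepth
import Literature.Computability.Complexity.CircuitClasses
import Literature.Computability.Complexity.CircuitComposition
import Literature.Computability.Complexity.CircuitLowerBoundsHastadProofs
import Literature.Computability.Complexity.PolyHierarchy
import Literature.Computability.Complexity.KannanLanguage
import Literature.Computability.Complexity.NondeterministicProofs
import Literature.Computability.Complexity.CountingHierarchyPH
import Literature.Computability.Complexity.CNF
import Literature.Computability.MetaComplexity.BranchingPrograms
import Literature.Computability.Complexity.SigmaDepth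

/-!
# `RootDecompBranchingProgram.KannanBPCellQuad` (stmt-PneNP-30178) — the Kannan cell of the BP-size dial at scale n²

Node N26 of the decomp-pnenp root-decomposition cell (route `route-PneNP-RootDecompBranchingProgram`,
lens-4 g8 «BranchingProgramLift») cuts the root on the SIZE dial of deterministic branching programs at
«all polynomials» (`L/poly`).  Every FIXED polynomial scale of that dial is a DECIDED cell (LAW II, «Kannan
cells»): were SAT easy, Kannan's `Σ₄ᵖ` language outside `SIZE(c·n^{2k} + c)` (tree theorem
`Kannan.exists_mem_SigmaP_four_not_mem_SIZE`) would be pulled into `P` by the collapse of constant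
alternations, while a branching-program family of size `n^k` (a.e.) converts into a `B₂`-circuit family
of size `O(n^{2k})` (each of the `m` inner nodes becomes a multiplexer, `m` relaxation layers; Wegener 2000
§1.1).  This file lands the decided row at `k = 2`: `NP ⊆ P → ¬ (P ⊆ BP[n²])` (BC5 rung surface of
A_BP).  Port of the lens kernel `transferAt_pow 2` = `kannan_BP_cell 2` with its BP → circuit accounting
(HOME/decomp-pnenp-lens-4/BranchingProgramLift.lean sha256 228264da…, critic CLEARED 06:51:54Z / anchor
`Anchor_N26_BranchingProgram.lean`); census tribunal batch 1 (TRIB-PNENP-ROOTDECOMP-1) and the cell's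
cycle-2 order list the item as provable-now.  0 sorry.
[cite: Kannan1982, Lemma 1; Wegener2000, §1.1; AroraBarak2009, §14.4.4]
-/

namespace Summit.PneNP.PneNP.Theorems.RootDecompBranchingProgramPort

open Literature.Computability.Complexity
open Literature.Computability.MetaComplexity
open Summit.PneNP.PneNP.Theorems

/-! ## BP → B₂-circuit (m layers of m multiplexers), with size accounting — port of the lens section `BPToCircuit` -/

namespace BPToCircuit

variable {n : ℕ} (P : BranchingProgram n)

/-- Wires of the layered simulation: the inputs, then one wire per position (inner node or sink). -/
abbrev Wire (P : BranchingProgram n) : Type := Fin n ⊕ (Fin P.m ⊕ Bool)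

/-- Layer `0`: the inputs, every node wire `false`, the two sink wires their constants (= `evalFrom x 0`). -/
def initF (x : Fin n → Bool) : Wire P → Bool :=
  Sum.elim x (fun s => P.evalFrom x 0 s)

/-- One relaxation layer: every node wire becomes the multiplexer of its two successor wires.
[cite: Wegener2000, §1.1] -/
def stepF (y : Wire P → Bool) : Wire P → Bool :=
  Sum.elim (fun i => y (Sum.inl i))
    (Sum.elim (fun v => (y (Sum.inl (P.var v)) && y (Sum.inr (P.next v true)) ||
        !y (Sum.inl (P.var v)) && y (Sum.inr (P.next v false))))
      (fun b => y (Sum.inr (Sum.inr b))))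

/-- Layer `t` carries `evalFrom x t` on every position wire. -/
theorem iterate_stepF_initF (x : Fin n → Bool) :
    ∀ t : ℕ, (stepF P)^[t] (initF P x) = Sum.elim x (fun s => P.evalFrom x t s)
  | 0 => rfl
  | t + 1 => by
    rw [Function.iterate_succ_apply', iterate_stepF_initF x t]
    funext w
    rcases w with i | v | b
    · rfl
    · simp only [stepF, Sum.elim_inl, Sum.elim_inr, BranchingProgram.evalFrom_succ_inl]
      cases x (P.var v) <;> simp
    · simp [stepF]

/-- Compressed rank: the number of inner nodes of strictly smaller rank (a rank function `< m`). -/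
def crank (v : Fin P.m) : ℕ := (Finset.univ.filter fun w : Fin P.m => P.rank w < P.rank v).card

/-- `crank` is strictly monotone along `rank`. -/
theorem crank_lt_of_rank_lt {v w : Fin P.m} (h : P.rank w < P.rank v) : crank P w < crank P v := by
  unfold crank
  apply Finset.card_lt_card
  rw [Finset.ssubset_iff_subset_ne]
  refine ⟨fun u hu => ?_, fun heq => ?_⟩
  · simp only [Finset.mem_filter, Finset.mem_univ, true_and] at hu ⊢
    exact hu.trans h
  · have hw : w ∈ Finset.univ.filter fun u : Fin P.m => P.rank u < P.rank v := by simp [h]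
    rw [← heq] at hw
    simp at hw

/-- `crank` is below the number of inner nodes. -/
theorem crank_lt_size (v : Fin P.m) : crank P v < P.m := by
  unfold crank
  have hss : (Finset.univ.filter fun w : Fin P.m => P.rank w < P.rank v) ⊂ Finset.univ := by
    rw [Finset.ssubset_univ_iff]
    intro h
    have hv : v ∈ Finset.univ.filter fun w : Fin P.m => P.rank w < P.rank v := by
      rw [h]; exact Finset.mem_univ v
    simp at hv
  simpa using Finset.card_lt_card hss

/-- The rank-compressed program: same nodes, edges and start; rank `crank`. -/
def compress : BranchingProgram n where
  m := P.m
  var := P.var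
  next := P.next
  start := P.start
  rank := crank P
  rank_lt := fun v b w h => crank_lt_of_rank_lt P (P.rank_lt v b w h)

/-- The compressed program evaluates like the original at every fuel. -/
theorem evalFrom_compress (x : Fin n → Bool) :
    ∀ (fuel : ℕ) (s : Fin (compress P).m ⊕ Bool), (compress P).evalFrom x fuel s = P.evalFrom x fuel s
  | fuel, Sum.inr b => by cases fuel <;> rfl
  | 0, Sum.inl v => rfl
  | fuel + 1, Sum.inl v => by
    show (compress P).evalFrom x fuel (P.next v (x (P.var v))) =
      P.evalFrom x fuel (P.next v (x (P.var v)))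
    exact evalFrom_compress x fuel _

/-- Fuel `m` (the size) already suffices at the start node. [folklore] -/
theorem evalFrom_size_eq_eval {v : Fin P.m} (hs : P.start = Sum.inl v) (x : Fin n → Bool) :
    P.evalFrom x P.m (Sum.inl v) = P.eval x := by
  have h1 : ∀ fuel, crank P v + 1 ≤ fuel →
      P.evalFrom x fuel (Sum.inl v) = P.evalFrom x (crank P v + 1) (Sum.inl v) := by
    intro fuel hf
    have := (compress P).evalFrom_eq_of_le x fuel (Sum.inl v) hf
    rw [evalFrom_compress, evalFrom_compress] at this
    exact this
  have h2 : ∀ fuel, P.rank v + 1 ≤ fuel → P.evalFrom x fuel (Sum.inl v) = P.eval x := by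
    intro fuel hf
    rw [BranchingProgram.eval, hs]
    exact P.evalFrom_eq_of_le x fuel (Sum.inl v) hf
  have h3 := h1 (max P.m (P.rank v + 1))
    (le_trans (Nat.succ_le_of_lt (crank_lt_size P v)) (le_max_left _ _))
  have h4 := h2 (max P.m (P.rank v + 1)) (le_max_right _ _)
  have h5 := h1 P.m (crank_lt_size P v)
  rw [h5, ← h3, h4]

/-- Size bookkeeping: `(m + 2) + 4m² ≤ 7N² + 7` for `m ≤ N`. -/
theorem bound_le {m N : ℕ} (h : m ≤ N) : (m + 2) + m * (m * 4) ≤ 7 * N ^ 2 + 7 := by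
  have h1 : m * m ≤ N * N := Nat.mul_le_mul h h
  have h2 : N ≤ N ^ 2 := Nat.le_self_pow two_ne_zero N
  nlinarith [h1, h2]

/-- **BP → B₂ straight-line program, with accounting**: a branching program with `m` inner nodes is
computed by `(m + 2) + 4m²` gates over `B₂` (`m + 2` constants, then `m` layers of `m` four-gate
multiplexers; built with the tree's `CktSize` calculus `pair`/`comp`/`iterate`/`cktSize_mux`).
[cite: Wegener2000, §1.1] [cite: Vollmer1999, §1.2] -/
theorem cktSize_eval : CktSize B2 (fun x (_ : Unit) => P.eval x) ((P.m + 2) + P.m * (P.m * 4)) := by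
  classical
  have hA : CktSize B2 (fun (_ : Fin n → Bool) (_ : Fin P.m) => false) (Fintype.card (Fin P.m) * 1) :=
    CktSize.pi_const fun _ => cktSize_const (Fin n) false
  have hB : CktSize B2 (fun (_ : Fin n → Bool) (b : Bool) => b) (Fintype.card Bool * 1) :=
    CktSize.pi_const fun b => cktSize_const (Fin n) b
  have hInit : CktSize B2 (initF P) (0 + (Fintype.card (Fin P.m) * 1 + Fintype.card Bool * 1)) :=
    ((CktSize.id B2).pair (hA.pair hB)).congr fun x w => by
      rcases w with i | v | b <;> rfl
  have hIn : CktSize B2 (fun (y : Wire P → Bool) (i : Fin n) => y (Sum.inl i)) 0 :=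
    CktSize.proj B2 _
  have hMux : CktSize B2 (fun (y : Wire P → Bool) (v : Fin P.m) =>
      (y (Sum.inl (P.var v)) && y (Sum.inr (P.next v true)) ||
        !y (Sum.inl (P.var v)) && y (Sum.inr (P.next v false)))) (Fintype.card (Fin P.m) * 4) :=
    CktSize.pi_const fun v => cktSize_mux _ _ _
  have hC : CktSize B2 (fun (y : Wire P → Bool) (b : Bool) => y (Sum.inr (Sum.inr b))) 0 :=
    CktSize.proj B2 _
  have hStep : CktSize B2 (stepF P) (0 + (Fintype.card (Fin P.m) * 4 + 0)) :=
    (hIn.pair (hMux.pair hC)).congr fun y w => by rcases w with i | v | b <;> rfl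
  have hIter := hStep.iterate P.m
  have hOut : CktSize B2 (fun (y : Wire P → Bool) (_ : Unit) => y (Sum.inr P.start)) 0 :=
    CktSize.proj B2 _
  have hAll := hInit.comp (hIter.comp hOut)
  refine (hAll.congr fun x u => ?_).of_le (le_of_eq ?_)
  · show ((stepF P)^[P.m] (initF P x)) (Sum.inr P.start) = P.eval x
    rw [iterate_stepF_initF]
    rcases hs : P.start with v | b
    · simpa using evalFrom_size_eq_eval P hs x
    · simp [BranchingProgram.eval, hs, BranchingProgram.fuelOf]
  · simp [Fintype.card_fin, Fintype.card_bool]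

/-- **A branching program of size `m` has an equivalent `B₂`-circuit of size `≤ (m + 2) + 4m²**.
[cite: Wegener2000, §1.1] -/
theorem exists_circuit : ∃ C : Circuit (Fin n), C.IsOver B2 ∧
    C.size ≤ (P.size + 2) + P.size * (P.size * 4) ∧ ∀ x, C.eval x = P.eval x := by
  obtain ⟨C, h1, h2, h3⟩ := (cktSize_eval P).toCircuit
  exact ⟨C, h1, h2, fun x => h3 x⟩

end BPToCircuit

/-- **`BP[nᵏ] ⊆ SIZE(c·n^{2k} + c)`**: an a.e. polynomial-size branching-program family is an everywhere
`O(n^{2k})`-size circuit family (finitely many small lengths absorbed in the constant).  Port of the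
lens lemma. [cite: Wegener2000, §1.1] -/
theorem exists_SIZE_of_mem_BPSIZEae_pow {k : ℕ} {L : Language Bool}
    (hL : L ∈ BPSIZEae (fun n => n ^ k)) :
    ∃ c : ℕ, L ∈ SIZE (fun n => c * n ^ (2 * k) + c) := by
  classical
  obtain ⟨Q, ⟨n₀, hn₀⟩, hQ⟩ := hL
  choose C hC using fun n => BPToCircuit.exists_circuit (Q n)
  set M : ℕ := (Finset.range n₀).sup (fun n => ((Q n).size + 2) + (Q n).size * ((Q n).size * 4))
    with hM
  refine ⟨7 + M, C, fun n => ⟨(hC n).1, ?_⟩, fun x => by rw [(hC _).2.2]; exact hQ x⟩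
  by_cases hn : n₀ ≤ n
  · have hm : (Q n).size ≤ n ^ k := hn₀ n hn
    calc (C n).size ≤ ((Q n).size + 2) + (Q n).size * ((Q n).size * 4) := (hC n).2.1
      _ ≤ 7 * (n ^ k) ^ 2 + 7 := BPToCircuit.bound_le hm
      _ ≤ (7 + M) * n ^ (2 * k) + (7 + M) := by
        rw [pow_mul']
        exact Nat.add_le_add (Nat.mul_le_mul_right _ (Nat.le_add_right 7 M)) (Nat.le_add_right 7 M)
  · have hlt : n < n₀ := Nat.lt_of_not_le hn
    have hle : ((Q n).size + 2) + (Q n).size * ((Q n).size * 4) ≤ M :=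
      Finset.le_sup (f := fun n => ((Q n).size + 2) + (Q n).size * ((Q n).size * 4))
        (Finset.mem_range.2 hlt)
    calc (C n).size ≤ ((Q n).size + 2) + (Q n).size * ((Q n).size * 4) := (hC n).2.1
      _ ≤ M := hle
      _ ≤ (7 + M) * n ^ (2 * k) + (7 + M) := (Nat.le_add_left M 7).trans (Nat.le_add_left _ _)

/-- **KANNAN CELL** (port of the lens theorem `kannan_BP_cell`): were SAT easy, some polynomial-time
language would lie outside `BP[nᵏ]` — Kannan's `Σ₄ᵖ` language outside `SIZE(c·n^{2k} + c)`, pulled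
into `P` by the collapse (tree `SigmaP_subset_P_of_NP_subset_P`), converted by
`exists_SIZE_of_mem_BPSIZEae_pow`. [cite: Kannan1982, Lemma 1] -/
theorem kannan_BP_cell (k : ℕ) (hNP : Nondeterministic.NP ⊆ Classes.P) :
    ∃ L ∈ Classes.P, L ∉ BPSIZEae (fun n => n ^ k) := by
  obtain ⟨L, hL4, hLs⟩ := Kannan.exists_mem_SigmaP_four_not_mem_SIZE (2 * k)
  refine ⟨L, SigmaP_subset_P_of_NP_subset_P hNP 4 hL4, fun hBP => hLs ?_⟩
  obtain ⟨c, hc⟩ := exists_SIZE_of_mem_BPSIZEae_pow hBP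
  exact Set.mem_iUnion.2 ⟨c, hc⟩

end Summit.PneNP.PneNP.Theorems.RootDecompBranchingProgramPort

namespace Summit.PneNP.PneNP.Theorems

/-- The Kannan BP cell at the quadratic scale (stmt-PneNP-30178, `KannanBPCellQuad`):
`NP ⊆ P → ¬ (P ⊆ BP[n²])` — the SAT algorithm designs a polynomial-time language hard for quadratic-size
branching programs (Kannan's `Σ₄ᵖ` language outside `SIZE(c·n⁴ + c)`, collapse of constant alternations,
BP → circuit simulation).  Port of the lens-4 g8 kernel `transferAt_pow 2` (decomp-pnenp cell,
2026-08-30). [cite: Kannan1982, Lemma 1; Wegener2000, §1.1] -/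
theorem kannanBPCellQuad_proof :
    Summit.PneNP.PneNP.Theses.RootDecompBranchingProgram.KannanBPCellQuad := by
  unfold Summit.PneNP.PneNP.Theses.RootDecompBranchingProgram.KannanBPCellQuad
  intro hNP hP
  obtain ⟨L, hLP, hLs⟩ := RootDecompBranchingProgramPort.kannan_BP_cell 2 hNP
  exact hLs (hP hLP)

end Summit.PneNP.PneNP.Theorems
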